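import Mathlib.Algebra.Group.Subgroup.Pointwise
import Mathlib.GroupTheory.Subgroup.Centralizer
import Mathlib.Topology.Algebra.Group.Basic
import Mathlib.Topology.Algebra.ContinuousMonoidHom
import Mathlib.Data.Finset.Image
import HarnessLib

/-!
# Transport of «finitely many conjugacy classes of centralisers» along a group isomorphism (bookkeeping for Platonov–Rapinchuk §6.4 ∕ Rogawski 1990 §3.6)

Topic `GroupTheory`; namespace `Literature.GroupTheory`.  THEOREMS ONLY (no definition, no instance, no notation, no named fact, no `sorry`); Mathlib only.  Cell
`pub/hodgecm-mathlib`, crux H413 = `stmt-HodgeConjecture-24833` (supports-only lane), brick (B7b-pre) «CARTAN-CLASS-TRANSPORT» of the p03 lineage's «CARTAN-FIN (N1)» road: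
the finiteness of conjugacy classes of Cartan subgroups (centralisers `Z(γ)` of «regular» elements) proved in the one-place matrix model `U(σ_w, Φ_w)(L_w)` is carried to the
organ's carrier `U(Φ₃)(L⁺_v)` along the topological isomorphism ★ `localNonsplitEquiv`.

* `map_centralizer_singleton_mulEquiv` — `e(Z(g)) = Z(e g)` for `e : G ≃* G'`;
* `map_map_conj_mulEquiv` — `e(u T u⁻¹) = (e u) e(T) (e u)⁻¹`;
* **`exists_finset_centralizers_of_mulEquiv`** — if `P g ↔ P' (e g)` and `G'` has a finite set of representatives, up to conjugacy, of the centralisers of its `P'`-elements, then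
  so has `G` for its `P`-elements (representatives `e⁻¹(T')`);
* `isCompact_map_continuousMulEquiv_iff` — compactness of `e(T)` for `e : G ≃ₜ* G'`; `isCompact_map_conj_iff` — compactness is conjugation invariant.
[cite: PlatonovRapinchuk1994, §6.4] -/

set_option autoImplicit false

namespace Literature.GroupTheory

open scoped Pointwise

section Algebraic

variable {G G' : Type*} [Group G] [Group G']

/-- `e(Z(g)) = Z(e g)` for a group isomorphism `e`. [cite: PlatonovRapinchuk1994, §6.4] -/
theorem map_centralizer_singleton_mulEquiv (e : G ≃* G') (g : G) :
    (Subgroup.centralizer ({g} : Set G)).map e.toMonoidHom = Subgroup.centralizer ({e g} : Set G') := by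
  ext x
  rw [Subgroup.mem_map_equiv, Subgroup.mem_centralizer_singleton_iff, Subgroup.mem_centralizer_singleton_iff]
  constructor
  · intro h
    have h2 := congrArg e h
    rwa [map_mul, map_mul, MulEquiv.apply_symm_apply] at h2
  · intro h
    apply e.injective
    rw [map_mul, map_mul, MulEquiv.apply_symm_apply]
    exact h

/-- `e(u T u⁻¹) = (e u) e(T) (e u)⁻¹`. [cite: PlatonovRapinchuk1994, §6.4] -/
theorem map_map_conj_mulEquiv (e : G ≃* G') (T : Subgroup G) (u : G) :
    (T.map (MulAut.conj u).toMonoidHom).map e.toMonoidHom = (T.map e.toMonoidHom).map (MulAut.conj (e u)).toMonoidHom := by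
  rw [Subgroup.map_map, Subgroup.map_map]
  congr 1
  ext x
  simp [MulAut.conj_apply, map_mul, map_inv]

/-- **Transport of a finite system of representatives of centraliser classes along `e : G ≃* G'`.**  If `P g ↔ P' (e g)` and `S'` is a finite set of centralisers `Z(γ')`
(`P' γ'`) such that every `Z(γ')`, `P' γ'`, is conjugate to a member of `S'`, then `S := e⁻¹(S')` does the same for `G`, `P`. [cite: PlatonovRapinchuk1994, §6.4] -/
theorem exists_finset_centralizers_of_mulEquiv (e : G ≃* G') {P : G → Prop} {P' : G' → Prop} (hP : ∀ g, P g ↔ P' (e g))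
    (h : ∃ S' : Finset (Subgroup G'), (∀ T' ∈ S', ∃ γ' : G', P' γ' ∧ T' = Subgroup.centralizer ({γ'} : Set G')) ∧
      ∀ γ' : G', P' γ' → ∃ T' ∈ S', ∃ u' : G', Subgroup.centralizer ({γ'} : Set G') = T'.map (MulAut.conj u').toMonoidHom) :
    ∃ S : Finset (Subgroup G), (∀ T ∈ S, ∃ γ : G, P γ ∧ T = Subgroup.centralizer ({γ} : Set G)) ∧
      ∀ γ : G, P γ → ∃ T ∈ S, ∃ u : G, Subgroup.centralizer ({γ} : Set G) = T.map (MulAut.conj u).toMonoidHom := by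
  classical
  obtain ⟨S', hS', hcov⟩ := h
  refine ⟨S'.image (fun T' => T'.map e.symm.toMonoidHom), ?_, ?_⟩
  · intro T hT
    obtain ⟨T', hT'S, rfl⟩ := Finset.mem_image.1 hT
    obtain ⟨γ', hP', rfl⟩ := hS' T' hT'S
    refine ⟨e.symm γ', (hP _).2 (by rw [MulEquiv.apply_symm_apply]; exact hP'), ?_⟩
    rw [map_centralizer_singleton_mulEquiv]
  · intro γ hγ
    obtain ⟨T', hT'S, u', hu'⟩ := hcov (e γ) ((hP γ).1 hγ)
    refine ⟨T'.map e.symm.toMonoidHom, Finset.mem_image_of_mem _ hT'S, e.symm u', ?_⟩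
    have h1 : (Subgroup.centralizer ({e γ} : Set G')).map e.symm.toMonoidHom = (T'.map (MulAut.conj u').toMonoidHom).map e.symm.toMonoidHom := by rw [hu']
    rw [map_centralizer_singleton_mulEquiv e.symm, MulEquiv.symm_apply_apply, map_map_conj_mulEquiv] at h1
    exact h1

/-- Compactness of a subgroup is invariant under conjugation (`u T u⁻¹` is a homeomorphic image of `T`). [cite: PlatonovRapinchuk1994, §6.4] -/
theorem isCompact_map_conj_iff [TopologicalSpace G] [IsTopologicalGroup G] (T : Subgroup G) (u : G) :
    IsCompact ((T.map (MulAut.conj u).toMonoidHom : Subgroup G) : Set G) ↔ IsCompact (T : Set G) := by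
  have hset : ((T.map (MulAut.conj u).toMonoidHom : Subgroup G) : Set G) = (Homeomorph.mulLeft u).trans (Homeomorph.mulRight u⁻¹) '' (T : Set G) := by
    ext x
    simp only [Subgroup.coe_map, MulEquiv.coe_toMonoidHom, MulAut.conj_apply, Set.mem_image, Homeomorph.trans_apply, Homeomorph.coe_mulLeft,
      Homeomorph.coe_mulRight, SetLike.mem_coe]
  rw [hset]
  exact (Homeomorph.isCompact_image _).trans Iff.rfl

end Algebraic

section Topological

variable {G G' : Type*} [Group G] [Group G'] [TopologicalSpace G] [TopologicalSpace G']

/-- Compactness of `e(T)` for a topological group isomorphism `e : G ≃ₜ* G'`. [cite: PlatonovRapinchuk1994, §6.4] -/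
theorem isCompact_map_continuousMulEquiv_iff (e : G ≃ₜ* G') (T : Subgroup G) :
    IsCompact ((T.map (e : G ≃* G').toMonoidHom : Subgroup G') : Set G') ↔ IsCompact (T : Set G) := by
  have hset : ((T.map (e : G ≃* G').toMonoidHom : Subgroup G') : Set G') = (e : G ≃ₜ G') '' (T : Set G) := by
    ext x
    simp only [Subgroup.coe_map, MulEquiv.coe_toMonoidHom, Set.mem_image, SetLike.mem_coe]
    rfl
  rw [hset]
  exact (e : G ≃ₜ G').isCompact_image

end Topological

end Literature.GroupTheory
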